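/-
Copyright (c) 2026 the pub-hodgecm-mathlib formalisation cell (harness21).  Prover seat hodgecm-mathlib-LH4-p16 (g0), req620 Track A «(D-RAM) FOUR-FRAME» squad
(STAGE-1b, row (2) of the piece `f_{T₊}`, the (β₂) road under heir LEAD F0P3a-plan (g21) T20-18∕T20-19 (R-36) «PURE-CELL LEDGER, RELATIVE SIGNS»; row (L-K) holder;
β₂-board sub-dealer LH4-p04 (g8) BETA2-BOARD v1.1), 2026-09-04.
-/
import Summits.HodgeConjecture.HodgeConjecture.Theorems.F0P3cDyRamDepthFormLineModel   -- ★ p861372 (this seat): HEAD B `valueSet_endoGL_sub_one_glued_eq_normFormSet_of_gen`, `v_thicken_iff_map`; brings ★ p861311, ★ DEFS `IsOrd ∕ dualGen`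
import Summits.HodgeConjecture.HodgeConjecture.Theorems.F0P3cDyRamConeCellFaceAxis      -- ★ p861154 (LH4-p15 (g0)): `valueSetMod_smul_xPlus_eq_plus_iff_exists_norm`, `image_mul_valueSetMod_smul_xPlus`; brings ★ (L-lab-3) `valueSetMod_smul_xPlus`, ★ `refSkewScalar_ne_zero`
import HarnessLib

/-!
# Crux `H413`, line LH4 «(D-RAM) FOUR-FRAME» — STAGE-1b, row (2), the (β₂) road (R-36): «THE DEPTH SCALAR» — the `a`-ray of ★ p861372's norm-form letter of the vertex over
# `Λ = x₀·𝒪_j` is `valueSetMod σ ϖ m ((e₀·t₊⁻¹) • X₊)` with `jE e₀ = Tr_ρ(c_Λ)`, `c_Λ = (lam − jE u₀₀)∕(ϖE^j(α − ρα)·ΘY) = κ_Λ∕Θ(ϖE^j(α − ρα))`; a RAY-DOMINATED vertex has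
# exactly this letter, so its label is the norm class of ONE scalar `e₀∕t₊` — relative signs along the board's maps are classes of RATIOS of depth scalars

Cell `hodgecm-mathlib` (D-0151), FLOOR 0, crux item H413 = `stmt-HodgeConjecture-24833`, route of record `HCCMUnconditional`; squad F0∕P3c∕LH4; lane
`--supports stmt-HodgeConjecture-24833 --as helper` (count-neutral; pays NO tier-0 row).  THEOREMS ONLY (no `def`, no instance, no notation, no `sorry`, default heartbeats);
★-only imports; states NO law; (β₂) stays a HYPOTHESIS.  DATUM-FREE except §4 (the class dictionary at `m* = mstarOfRecord d` needs the sheet datum on `E`).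

WHY (heir LEAD T20-19 «RELATIVE SIGNS»; β₂-BOARD v1.1: rows (L-D×) LH4-p19, (L-S1)∕(L-T) LH4-p09, (L-K) this seat, (L-P) LH7-p09 — each a signed-count identity BETWEEN two
cells along an explicit map).  By ★ p861311 ∘ ★ p861372 (HEAD B) the letter of the self-dual vertex over `Λ = x₀·𝒪_j` (near `1`: `|u₀₀ − 1| ≤ |ϖ^m|`) is the `ϖ^m`-value set of
`(ζ, a) ↦ Tr_ρ(c_Λ·N_Θ(Y·ζ + jE a))` on `IsOrd ζ`, `|a| ≤ 1`, ONE scalar `c_Λ = (lam − jE u₀₀)∕(ϖE^j(α − ρα)·ΘY)` per `Λ` (`Y = dualGen x₀`).  Along a map `Λ ↦ Λ′` the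
row needs the RELATIVE label; THIS FILE isolates the scalar that carries it:
* §1 `trace_mul_norm_map_eq` — on the `a`-RAY (`ζ = 0`) the value is `jE(N a)·Tr_ρ(c_Λ)` (`Θ ∘ jE = jE ∘ σ`, `ρ` fixes `jE(E)`); `ray_eq_valueSetMod_smul_xPlus` — the thickened
  ray IS ★ (L-lab-3)'s `valueSetMod σ ϖ m ((e₀·t₊⁻¹) • X₊)` for any `e₀` with `jE e₀ = Tr_ρ(c_Λ)` (`t₊` = the reference skew scalar of `xPlus σ ϖ d`).
* §2 `ray_subset_normFormSet` — the ray lies IN the letter (`IsOrd 0`); `normFormSet_eq_ray_of_small` — RAY-DOMINATED (`hsmall`: every `(ζ, a)`-value is `ϖ^m`-close to its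
  `a`-ray value `jE(N a)·Tr_ρ(c_Λ)` — the per-cell valuation estimate of the rows) ⇒ the letter IS the ray set.
* §3 `depthCoeff_eq_div` — `c_Λ = κ_Λ ∕ Θ(ϖE^j(α − ρα))` with the DEPTH QUOTIENT `κ_Λ := (lam − jE u₀₀)∕Y ∈ 𝒪_j` (★ DEFS `forall_herm_mul_mem_iff_isOrd_div`: the depth clause),
  because `Y∕ΘY = ϖE^j(α − ρα)∕Θ(ϖE^j(α − ρα))` for `Y = h_M·N_Θ(x₀)·ϖE^j(α − ρα)`, `Θh_M = h_M`; `depthCoeff_mul_left` — under `x₀ ↦ ε·x₀` with `ε·Θε = ξ`, `Θξ = ξ`: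
  `c ↦ c∕ξ` (so `e₀ ↦ e₀∕ξ` for `ξ ∈ jE(E)`: the flip law of ★ p861311 §3 read on the scalar).
* §4 HEAD `labelPlus_iff_exists_norm_of_ray` — at `m* = mstarOfRecord d` with the sheet datum on `E` and `e₀∕t₊` a `σ`-FIXED unit: a ray-dominated vertex is labelled `+` iff
  `e₀∕t₊ ∈ N(Eˣ)` (★ p861154 `valueSetMod_smul_xPlus_eq_plus_iff_exists_norm`); hence along any map multiplying the depth scalar by a `σ`-fixed unit `ν` the label is KEPT iff
  `ν ∈ N(Eˣ)` and REVERSED iff not (`labelPlus_map_iff_of_ray`, ★ `isNorm_iff_not_isNorm_div`) — the (R-36) relative sign, with no absolute sign and no `σ(u)` anywhere.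
HONEST LABEL.  Count-neutral; nothing printed is asserted; no census law is stated; which cells are ray-dominated and which maps multiply `e₀` by which `ν` are the ROWS' business;
`HC_CM` is proved only modulo the 7 printed citations (2 remaining named inputs: hLiu418 = `stmt-HodgeConjecture-24832`, h413 = `stmt-HodgeConjecture-24833`) until rung 0 closes.
## References
* [Jacobowitz1962] R. Jacobowitz, *Hermitian forms over local fields*, Amer. J. Math. 84 (1962): §4 (dual lattices, gluing; hermitian lines).
* [Rogawski1990] J. D. Rogawski, *Automorphic Representations of Unitary Groups in Three Variables*, Ann. of Math. Stud. 123 (1990): §4.9 Prop. 4.9.1 (b) p. 55.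
* [Serre1979] J.-P. Serre, *Local Fields*, GTM 67 (1979): Ch. V §3 Cor. 3 (norm classes of units; index two).
* [LabesseLanglands1979] J.-P. Labesse, R. P. Langlands, *L-indistinguishability for SL(2)*, Canad. J. Math. 31 (1979): §2 p. 8.
* [Kottwitz1986BaseChangeUnits] R. E. Kottwitz, *Base change for unit elements of Hecke algebras*, Compositio Math. 60 (1986): §1 pp. 240–241.
-/

set_option autoImplicit false

noncomputable section

namespace Summit.HodgeConjecture.HodgeConjecture.Cruxes.H413.F0P3cDyRamDepthScalar

open scoped Valued WithZero Matrix MatrixGroups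
open WithZero
open Literature.NumberTheory.Automorphic Literature.NumberTheory.Automorphic.HermitianLattice Literature.NumberTheory.Automorphic.UnitaryLatticeTree
open Literature.NumberTheory.Automorphic.UnitaryThreeFourFrame (IsRamifiedQuadraticDatum)
open Literature.NumberTheory.LocalFields.WildQuadraticDatum (refSkewScalar_ne_zero)
open Summit.HodgeConjecture.HodgeConjecture.Cruxes.H413.F0P3cDyRamFourFramePieces
open Summit.HodgeConjecture.HodgeConjecture.Cruxes.H413.F0P3cDyRamToricCensusDefs
open Summit.HodgeConjecture.HodgeConjecture.Cruxes.H413.F0P3cDyRamSmulXPlusLabel (valueSetMod_smul_xPlus)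
open Summit.HodgeConjecture.HodgeConjecture.Cruxes.H413.F0P3cDyRamConeCellFaceAxis (valueSetMod_smul_xPlus_eq_plus_iff_exists_norm image_mul_valueSetMod_smul_xPlus)
open Summit.HodgeConjecture.HodgeConjecture.Cruxes.H413.F0P3cDyRamConeWeightHalfSplit (isNorm_iff_not_isNorm_div)
open Summit.HodgeConjecture.HodgeConjecture.Cruxes.H413.F0P3cDyRamDepthFormLineModel (v_thicken_iff_map)

variable {E : Type} {M : Type*} [Field E] [Valued E ℤᵐ⁰] [Field M] [Valued M ℤᵐ⁰] {ρ Θ : M →+* M} {α : M}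

/-! ## §1 The `a`-ray of the norm-form letter is `valueSetMod σ ϖ m ((e₀·t₊⁻¹) • X₊)` -/

omit [Valued E ℤᵐ⁰] [Valued M ℤᵐ⁰] in
/-- **ON THE `a`-RAY THE VALUE IS `jE(N a)·Tr_ρ(c)`**: `c·N_Θ(Y·0 + jE a) + ρ(…) = jE(a·σa)·(c + ρc)` (`Θ ∘ jE = jE ∘ σ`; `ρ` fixes `jE(E)`). [cite: Jacobowitz1962, §4] -/
theorem trace_mul_norm_map_eq (σ : E →+* E) (jE : E →+* M) (hΘj : ∀ x, Θ (jE x) = jE (σ x)) (hjfix : ∀ z, ρ z = z ↔ ∃ c, jE c = z) (c Y : M) (a : E) :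
    c * ((Y * 0 + jE a) * Θ (Y * 0 + jE a)) + ρ (c * ((Y * 0 + jE a) * Θ (Y * 0 + jE a))) = jE (a * σ a) * (c + ρ c) := by
  have hρa : ρ (jE (a * σ a)) = jE (a * σ a) := (hjfix _).2 ⟨a * σ a, rfl⟩
  rw [mul_zero, zero_add, hΘj, ← map_mul, map_mul ρ, hρa]
  ring

/-- **THE THICKENED `a`-RAY IS `valueSetMod σ ϖ m ((e₀·t₊⁻¹) • X₊)`** for any `e₀ ∈ E` with `jE e₀ = c + ρc` (`t₊ = (ϖ − σϖ)·((ϖσϖ)^{⌊d∕2⌋})⁻¹ ≠ 0`; thickening moved across `jE` by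
★ `v_thicken_iff_map`). [cite: Rogawski1990, §4.9 Prop. 4.9.1 (b) p. 55] [cite: Jacobowitz1962, §4] -/
theorem ray_eq_valueSetMod_smul_xPlus (σ : E →+* E) (hvσ : ∀ a, Valued.v (σ a) = Valued.v a) {ϖ : E} (hϖ : Valued.v ϖ = exp (-1 : ℤ)) {d : ℕ}
    (hd : Valued.v (ϖ - σ ϖ) = Valued.v ϖ ^ d) (jE : E →+* M) (hjv : ∀ c, Valued.v (jE c) ≤ 1 ↔ Valued.v c ≤ 1)
    (hΘj : ∀ x, Θ (jE x) = jE (σ x)) (hjfix : ∀ z, ρ z = z ↔ ∃ c, jE c = z) (c Y : M) {e₀ : E} (he₀ : jE e₀ = c + ρ c) (m : ℕ) :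
    {z : E | ∃ a : E, Valued.v a ≤ 1 ∧ Valued.v ((jE ϖ ^ m)⁻¹ * (jE z - (c * ((Y * 0 + jE a) * Θ (Y * 0 + jE a)) + ρ (c * ((Y * 0 + jE a) * Θ (Y * 0 + jE a)))))) ≤ 1} =
      valueSetMod σ ϖ m ((e₀ * ((ϖ - σ ϖ) * ((ϖ * σ ϖ) ^ ((d - d % 2) / 2))⁻¹)⁻¹) • xPlus σ ϖ d) := by
  have ht0 := refSkewScalar_ne_zero hvσ hϖ hd
  rw [valueSetMod_smul_xPlus]
  ext z
  simp only [Set.mem_setOf_eq]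
  refine exists_congr fun a => and_congr_right fun _ => ?_
  rw [trace_mul_norm_map_eq σ jE hΘj hjfix c Y a, ← he₀, ← map_mul, ← v_thicken_iff_map jE hjv,
    show e₀ * ((ϖ - σ ϖ) * ((ϖ * σ ϖ) ^ ((d - d % 2) / 2))⁻¹)⁻¹ * ((ϖ - σ ϖ) * ((ϖ * σ ϖ) ^ ((d - d % 2) / 2))⁻¹ * (a * σ a)) = a * σ a * e₀ by
      rw [mul_assoc, ← mul_assoc (((ϖ - σ ϖ) * ((ϖ * σ ϖ) ^ ((d - d % 2) / 2))⁻¹)⁻¹), inv_mul_cancel₀ ht0, one_mul, mul_comm]]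

/-! ## §2 The ray lies in the letter; a ray-dominated vertex has the ray as its letter -/

/-- **THE `a`-RAY LIES IN THE NORM-FORM LETTER** (`ζ = 0` is in every order). [cite: Jacobowitz1962, §4] [cite: Rogawski1990, §4.9 Prop. 4.9.1 (b) p. 55] -/
theorem ray_subset_normFormSet (jE : E →+* M) (ϖ : E) (m : ℕ) (cc c Y : M) :
    {z : E | ∃ a : E, Valued.v a ≤ 1 ∧ Valued.v ((jE ϖ ^ m)⁻¹ * (jE z - (c * ((Y * 0 + jE a) * Θ (Y * 0 + jE a)) + ρ (c * ((Y * 0 + jE a) * Θ (Y * 0 + jE a)))))) ≤ 1} ⊆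
      {z : E | ∃ (ζ : M) (a : E), IsOrd ρ α cc ζ ∧ Valued.v a ≤ 1 ∧
        Valued.v ((jE ϖ ^ m)⁻¹ * (jE z - (c * ((Y * ζ + jE a) * Θ (Y * ζ + jE a)) + ρ (c * ((Y * ζ + jE a) * Θ (Y * ζ + jE a)))))) ≤ 1} := by
  rintro z ⟨a, ha, hz⟩
  refine ⟨0, a, ?_, ha, hz⟩
  rw [isOrd_iff]
  exact ⟨by rw [map_zero]; exact zero_le, by rw [map_zero, sub_zero, map_zero]; exact zero_le⟩

/-- **A RAY-DOMINATED VERTEX HAS THE RAY AS ITS LETTER.**  If every `(ζ, a)`-value (`IsOrd ζ`, `|a| ≤ 1`) is `ϖ^m`-close to its `a`-ray value (`hsmall` — the per-cell estimate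
of the board rows: the `ζ`-terms `Tr_ρ(c·(Y ζ·Θ(jE a) + jE a·Θ(Yζ) + N_Θ(Yζ)))` lie in `ϖ^m`), then the norm-form letter of ★ p861372 HEAD B EQUALS the thickened ray, i.e.
`valueSetMod σ ϖ m ((e₀·t₊⁻¹) • X₊)`. [cite: Rogawski1990, §4.9 Prop. 4.9.1 (b) p. 55] [cite: Jacobowitz1962, §4] -/
theorem normFormSet_eq_ray_of_small (σ : E →+* E) (hvσ : ∀ a, Valued.v (σ a) = Valued.v a) {ϖ : E} (hϖ : Valued.v ϖ = exp (-1 : ℤ)) {d : ℕ}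
    (hd : Valued.v (ϖ - σ ϖ) = Valued.v ϖ ^ d) (jE : E →+* M) (hjv : ∀ c, Valued.v (jE c) ≤ 1 ↔ Valued.v c ≤ 1)
    (hΘj : ∀ x, Θ (jE x) = jE (σ x)) (hjfix : ∀ z, ρ z = z ↔ ∃ c, jE c = z) (cc c Y : M) {e₀ : E} (he₀ : jE e₀ = c + ρ c) (m : ℕ)
    (hsmall : ∀ (ζ : M) (a : E), IsOrd ρ α cc ζ → Valued.v a ≤ 1 →
      Valued.v ((jE ϖ ^ m)⁻¹ * ((c * ((Y * ζ + jE a) * Θ (Y * ζ + jE a)) + ρ (c * ((Y * ζ + jE a) * Θ (Y * ζ + jE a)))) -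
        (c * ((Y * 0 + jE a) * Θ (Y * 0 + jE a)) + ρ (c * ((Y * 0 + jE a) * Θ (Y * 0 + jE a)))))) ≤ 1) :
    {z : E | ∃ (ζ : M) (a : E), IsOrd ρ α cc ζ ∧ Valued.v a ≤ 1 ∧
        Valued.v ((jE ϖ ^ m)⁻¹ * (jE z - (c * ((Y * ζ + jE a) * Θ (Y * ζ + jE a)) + ρ (c * ((Y * ζ + jE a) * Θ (Y * ζ + jE a)))))) ≤ 1} =
      valueSetMod σ ϖ m ((e₀ * ((ϖ - σ ϖ) * ((ϖ * σ ϖ) ^ ((d - d % 2) / 2))⁻¹)⁻¹) • xPlus σ ϖ d) := by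
  rw [← ray_eq_valueSetMod_smul_xPlus σ hvσ hϖ hd jE hjv hΘj hjfix c Y he₀ m]
  refine Set.Subset.antisymm ?_ (ray_subset_normFormSet (ρ := ρ) (α := α) jE ϖ m cc c Y)
  rintro z ⟨ζ, a, hζ, ha, hz⟩
  refine ⟨a, ha, ?_⟩
  -- `jE z − ray = (jE z − value) + (value − ray)`
  have e : (jE ϖ ^ m)⁻¹ * (jE z - (c * ((Y * 0 + jE a) * Θ (Y * 0 + jE a)) + ρ (c * ((Y * 0 + jE a) * Θ (Y * 0 + jE a))))) =
      (jE ϖ ^ m)⁻¹ * (jE z - (c * ((Y * ζ + jE a) * Θ (Y * ζ + jE a)) + ρ (c * ((Y * ζ + jE a) * Θ (Y * ζ + jE a))))) +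
        (jE ϖ ^ m)⁻¹ * ((c * ((Y * ζ + jE a) * Θ (Y * ζ + jE a)) + ρ (c * ((Y * ζ + jE a) * Θ (Y * ζ + jE a)))) -
          (c * ((Y * 0 + jE a) * Θ (Y * 0 + jE a)) + ρ (c * ((Y * 0 + jE a) * Θ (Y * 0 + jE a))))) := by ring
  rw [e]
  exact (Valuation.map_add _ _ _).trans (max_le hz (hsmall ζ a hζ ha))

/-! ## §3 The depth coefficient: `c_Λ = κ_Λ ∕ Θ(ϖE^j(α − ρα))`, `κ_Λ = (lam − jE u₀₀)∕Y`; the flip law -/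

omit [Valued M ℤᵐ⁰] in
/-- **THE DEPTH COEFFICIENT THROUGH THE DEPTH QUOTIENT**: for `Y = dualGen ρ Θ α cc h_M x₀ = h_M·(x₀Θx₀)·(cc(α − ρα))` with `Θh_M = h_M`, `Θ` an involution and all factors
non-zero, `μ∕(cc(α − ρα)·ΘY) = (μ∕Y) ∕ Θ(cc(α − ρα))` — because `Y∕ΘY = cc(α − ρα)∕Θ(cc(α − ρα))`.  (`κ = μ∕Y ∈ 𝒪_j` is the depth clause of `levelSetDep`, ★ DEFS
`forall_herm_mul_mem_iff_isOrd_div`.) [cite: Jacobowitz1962, §4] -/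
theorem depthCoeff_eq_div (hΘΘ : ∀ x, Θ (Θ x) = x) {cc hM x₀ : M} (hΘh : Θ hM = hM) (hcc : cc * (α - ρ α) ≠ 0) (hhM : hM ≠ 0) (hx₀ : x₀ ≠ 0) (μ : M) :
    μ / (cc * (α - ρ α) * Θ (dualGen ρ Θ α cc hM x₀)) = (μ / dualGen ρ Θ α cc hM x₀) / Θ (cc * (α - ρ α)) := by
  have hΘx₀ : Θ x₀ ≠ 0 := (map_ne_zero Θ).2 hx₀
  have hΘcc : Θ (cc * (α - ρ α)) ≠ 0 := (map_ne_zero Θ).2 hcc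
  rw [dualGen_def, map_mul, map_mul, map_mul Θ x₀, hΘΘ, hΘh]
  field_simp

omit [Valued M ℤᵐ⁰] in
/-- **THE FLIP LAW ON THE COEFFICIENT**: `x₀ ↦ ε·x₀` with `ε·Θε = ξ`, `Θξ = ξ` sends `μ∕(cc(α − ρα)·ΘY)` to itself divided by `ξ` (`dualGen(ε·x₀) = ξ·dualGen(x₀)`, ★
`dualGen_mul_left`). [cite: Jacobowitz1962, §4] -/
theorem depthCoeff_mul_left {ε ξ : M} (hε : ε * Θ ε = ξ) (hΘξ : Θ ξ = ξ) (hξ0 : ξ ≠ 0) (cc hM x₀ μ : M) :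
    μ / (cc * (α - ρ α) * Θ (dualGen ρ Θ α cc hM (ε * x₀))) = μ / (cc * (α - ρ α) * Θ (dualGen ρ Θ α cc hM x₀)) / ξ := by
  rw [Summit.HodgeConjecture.HodgeConjecture.Cruxes.H413.F0P3cDyRamConeCellLabelBalance.dualGen_mul_left, hε, map_mul, hΘξ]
  field_simp

/-! ## §4 HEAD — the label of a ray-dominated vertex is the norm class of `e₀∕t₊`; relative signs are classes of ratios -/

/-- **HEAD — «THE LABEL OF A RAY-DOMINATED VERTEX IS THE NORM CLASS OF ITS DEPTH SCALAR».**  At the level of record `m* = mstarOfRecord d` with the sheet datum on `E`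
(`IsRamifiedQuadraticDatum σ ϖ d t`, `E` adically complete), if the letter of a vertex is the ray set `valueSetMod σ ϖ m* ((e₀·t₊⁻¹) • X₊)` (§2) and `e₀·t₊⁻¹` is a `σ`-FIXED unit,
then the vertex is labelled `+` (letter `= valueSetMod σ ϖ m* X₊`) iff `e₀·t₊⁻¹ ∈ N(Eˣ)` (★ p861154 `valueSetMod_smul_xPlus_eq_plus_iff_exists_norm`).
[cite: Serre1979, Ch. V §3 Cor. 3] [cite: Rogawski1990, §4.9 Prop. 4.9.1 (b) p. 55] -/
theorem labelPlus_iff_exists_norm_of_ray [IsAdicComplete 𝓂[E] 𝒪[E]] {σ : E →+* E} {ϖ : E} {d t : ℕ} (hD : IsRamifiedQuadraticDatum σ ϖ d t)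
    {S : Set E} {e : E} (hS : S = valueSetMod σ ϖ (mstarOfRecord d) (e • xPlus σ ϖ d)) (hσe : σ e = e) (he1 : Valued.v e = 1) :
    S = valueSetMod σ ϖ (mstarOfRecord d) (xPlus σ ϖ d) ↔ ∃ z : E, z * σ z = e := by
  rw [hS]
  exact valueSetMod_smul_xPlus_eq_plus_iff_exists_norm hD hσe he1

/-- **RELATIVE SIGN ALONG A MAP MULTIPLYING THE DEPTH SCALAR BY A FIXED UNIT `ν`** (the (R-36) currency): two ray-dominated vertices with `σ`-fixed unit scalars `e` and `ν·e`
(`ν` a `σ`-fixed unit — e.g. `ν = ξ⁻¹` for a flip of multiplier `ξ ∈ F`, `ν = h∕h′` across literals with `h′∕h ∈ F`): if `ν ∈ N(Eˣ)` both carry the SAME label; if `ν ∉ N(Eˣ)`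
(`E` with finite residue field, complete) they carry OPPOSITE labels (★ `isNorm_iff_not_isNorm_div`). [cite: LabesseLanglands1979, §2 p. 8] [cite: Serre1979, Ch. V §3 Cor. 3] -/
theorem labelPlus_map_iff_of_ray [CompleteSpace E] [IsAdicComplete 𝓂[E] 𝒪[E]] [Finite 𝓀[E]] {σ : E →+* E} {ϖ : E} {d t : ℕ} (hD : IsRamifiedQuadraticDatum σ ϖ d t)
    {S S' : Set E} {e ν : E} (hS : S = valueSetMod σ ϖ (mstarOfRecord d) (e • xPlus σ ϖ d))
    (hS' : S' = valueSetMod σ ϖ (mstarOfRecord d) ((ν * e) • xPlus σ ϖ d))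
    (hσe : σ e = e) (he1 : Valued.v e = 1) (hσν : σ ν = ν) (hν1 : Valued.v ν = 1) :
    ((∃ z : E, z * σ z = ν) → (S' = valueSetMod σ ϖ (mstarOfRecord d) (xPlus σ ϖ d) ↔ S = valueSetMod σ ϖ (mstarOfRecord d) (xPlus σ ϖ d))) ∧
      ((¬ ∃ z : E, z * σ z = ν) → (S' = valueSetMod σ ϖ (mstarOfRecord d) (xPlus σ ϖ d) ↔ ¬ S = valueSetMod σ ϖ (mstarOfRecord d) (xPlus σ ϖ d))) := by
  have hσσ := hD.1
  have he0 : e ≠ 0 := fun h0 => by rw [h0, map_zero] at he1; exact zero_ne_one he1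
  have hν0 : ν ≠ 0 := fun h0 => by rw [h0, map_zero] at hν1; exact zero_ne_one hν1
  have hσνe : σ (ν * e) = ν * e := by rw [map_mul, hσν, hσe]
  have hνe1 : Valued.v (ν * e) = 1 := by rw [map_mul, hν1, he1, mul_one]
  rw [labelPlus_iff_exists_norm_of_ray hD hS hσe he1, labelPlus_iff_exists_norm_of_ray hD hS' hσνe hνe1]
  refine ⟨fun ⟨z₀, hz₀⟩ => ⟨fun ⟨z, hz⟩ => ⟨z / z₀, ?_⟩, fun ⟨z, hz⟩ => ⟨z₀ * z, ?_⟩⟩, fun hνN => ?_⟩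
  · have hz₀0 : z₀ ≠ 0 := fun h0 => by rw [h0, zero_mul] at hz₀; exact hν0 hz₀.symm
    have hσz₀0 : σ z₀ ≠ 0 := (map_ne_zero σ).2 hz₀0
    rw [map_div₀, div_mul_div_comm, hz, hz₀]; field_simp
  · rw [map_mul]; linear_combination (z * σ z) * hz₀ + ν * hz
  · -- `ν ∉ N`: `νe ∈ N ↔ e ∉ N` (index two: ★ `isNorm_iff_not_isNorm_div` at `r = νe`, `ξ = ν`)
    have h := isNorm_iff_not_isNorm_div hD hσνe (mul_ne_zero hν0 he0) hσν hνN
    rw [mul_div_cancel_left₀ e hν0] at h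
    exact h

end Summit.HodgeConjecture.HodgeConjecture.Cruxes.H413.F0P3cDyRamDepthScalar

end
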